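import Mathlib.RepresentationTheory.Semisimple
import Literature.NumberTheory.GaloisRepresentations.WeilDeligneSemisimpleTraces
import Summits.Langlands.Langlands.Theorems.IrreducibilityBySelfDualityReciprocityUpToIrreducibilityRStringDefs
import HarnessLib

/-!
# Strings in Frobenius-semisimple Weil–Deligne representations (structure theory, part 1: basics)

Helper file for stub S-17a-B `stub_isEquivalent_of_finrank_invariants_tprod_eq` of line `Sketch`
(crux stmt-Langlands-17925 `IrreducibilityBySelfDuality.ReciprocityUpToIrreducibilityR`): Henniart
2002 Thm 1.7 (a) on the Galois side reconstructs a Frobenius-semisimple Weil–Deligne representation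
from `Hom`-dimensions against indecomposables; the Galois-side input is Deligne's structure theorem
(Deligne, *Formes modulaires et représentations de GL(2)*, Antwerp II, LNM 349 (1973), Prop. 3.1.3;
Tate, Corvallis 1979, (4.1.5)): a Frobenius-semisimple `(ρ, N)` is a direct sum of STRINGS
`H ⊕ N H ⊕ ⋯ ⊕ N^{d-1} H` ("`ρ_H ⊗ Sp(d)`") with `H` an irreducible `W_F`-stable subspace.

This file (vocabulary in `…RStringDefs`): `W_F`-stable subspaces and sub-Weil–Deligne representations
(`ker N^j`, sums, intersections), strings (`string(P, d+1) = P + string(N P, d)`, additivity in the head),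
`W_F`-stable complements from Frobenius-semisimplicity (`IsFrobSemisimple.isSemisimpleRepresentation`),
existence of `W_F`-irreducible subspaces, and the registered sub-goal `stub_strMap_eq_zero_imp`
(independence of the pieces `H, N H, …, N^{d-1} H` of a string).  The key lemma and the string summands
are in part 2 (`…RStringSummand`).  Pure linear algebra over the tree's `WeilDeligneRep`; no definitions;
standard axioms only.
-/

noncomputable section

set_option linter.dupNamespace false

open Module
open Literature.NumberTheory.Automorphic Literature.NumberTheory.GaloisRepresentations
open Literature.NumberTheory.GaloisRepresentations.WeilGroup
open Literature.NumberTheory.GaloisRepresentations.IsNonarchimedeanLocalField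

namespace Summit.Langlands.Langlands.Theorems.ReciprocityUpToIrreducibilityR

variable {F : Type} [Field F] [ValuativeRel F] [TopologicalSpace F] [IsNonarchimedeanLocalField F]
variable {V : Type*} [AddCommGroup V] [Module ℂ V]

/-! ## `W_F`-stable subspaces -/

namespace IsWStable

variable {r : WeilDeligneRep F ℂ V}

/-- A `W_F`-stable subspace is closed under every `ρ(w)`. [folklore] -/
theorem apply_mem {p : Submodule ℂ V} (hp : IsWStable r p) (w : WeilGroup F) {v : V} (hv : v ∈ p) :
    r.ρ w v ∈ p := hp w hv

/-- `⊤` is `W_F`-stable. [folklore] -/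
theorem top : IsWStable r ⊤ := fun _ _ _ => trivial

/-- `⊥` is `W_F`-stable. [folklore] -/
theorem bot : IsWStable r ⊥ := fun w v hv => by
  rw [Submodule.mem_bot] at hv; simp [hv]

/-- Intersections of `W_F`-stable subspaces are `W_F`-stable. [folklore] -/
theorem inf {p q : Submodule ℂ V} (hp : IsWStable r p) (hq : IsWStable r q) : IsWStable r (p ⊓ q) :=
  fun w _ hv => ⟨hp w hv.1, hq w hv.2⟩

/-- Sums of `W_F`-stable subspaces are `W_F`-stable. [folklore] -/
theorem sup {p q : Submodule ℂ V} (hp : IsWStable r p) (hq : IsWStable r q) : IsWStable r (p ⊔ q) := by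
  intro w v hv
  obtain ⟨x, hx, y, hy, rfl⟩ := Submodule.mem_sup.mp hv
  rw [Submodule.mem_comap, map_add]
  exact Submodule.add_mem _ (Submodule.mem_sup_left (hp w hx)) (Submodule.mem_sup_right (hq w hy))

/-- Suprema of `W_F`-stable subspaces are `W_F`-stable. [folklore] -/
theorem iSup {ι : Sort*} {p : ι → Submodule ℂ V} (hp : ∀ i, IsWStable r (p i)) :
    IsWStable r (⨆ i, p i) := by
  intro w
  rw [← Submodule.map_le_iff_le_comap, Submodule.map_iSup]
  exact iSup_mono fun i => Submodule.map_le_iff_le_comap.mpr (hp i w)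

/-- The image `N^j p` of a `W_F`-stable subspace is `W_F`-stable. [cite: TateCorvallis1979, (4.1.5)] -/
theorem map_pow_N {p : Submodule ℂ V} (hp : IsWStable r p) (j : ℕ) : IsWStable r (p.map (r.N ^ j)) := by
  intro w
  rintro _ ⟨v, hv, rfl⟩
  rw [Submodule.mem_comap, ρ_pow_N_apply]
  exact Submodule.smul_mem _ _ ⟨r.ρ w v, hp w hv, rfl⟩

/-- `ker N^j` is `W_F`-stable. [cite: TateCorvallis1979, (4.1.5)] -/
theorem ker_pow_N (r : WeilDeligneRep F ℂ V) (j : ℕ) : IsWStable r (LinearMap.ker (r.N ^ j)) := by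
  intro w v hv
  rw [LinearMap.mem_ker] at hv
  rw [Submodule.mem_comap, LinearMap.mem_ker, pow_N_ρ_apply, hv, map_zero, smul_zero]

end IsWStable

/-- A sub-Weil–Deligne representation is `W_F`-stable. [folklore] -/
theorem isWStable_of_isSubrep {r : WeilDeligneRep F ℂ V} {p : Submodule ℂ V} (hp : r.IsSubrep p) :
    IsWStable r p := hp.1

/-! ## The string map and strings -/

section StrMap

variable (r : WeilDeligneRep F ℂ V)

/-- The string of length `0` is `0`. [folklore] -/
theorem stringSpan_zero (H : Submodule ℂ V) : stringSpan r H 0 = ⊥ := by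
  rw [eq_bot_iff]
  intro x hx
  obtain ⟨y, -, rfl⟩ := (mem_stringSpan_iff r).mp hx
  rw [strMap_apply, Finset.univ_eq_empty, Finset.sum_empty, Submodule.mem_bot]

/-- `string(P, d+1) = P + string(N P, d)`. [folklore] -/
theorem stringSpan_succ (P : Submodule ℂ V) (d : ℕ) :
    stringSpan r P (d + 1) = P ⊔ stringSpan r (P.map r.N) d := by
  apply le_antisymm
  · intro x hx
    obtain ⟨y, hy, rfl⟩ := (mem_stringSpan_iff r).mp hx
    rw [strMap_succ]
    exact Submodule.add_mem_sup (hy 0)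
      (strMap_mem_stringSpan r fun j => Submodule.mem_map_of_mem (hy j.succ))
  · refine sup_le (fun x hx => ?_) (fun x hx => ?_)
    · refine (mem_stringSpan_iff r).mpr ⟨Fin.cons x 0, fun j => ?_, ?_⟩
      · refine Fin.cases ?_ (fun i => ?_) j
        · simpa using hx
        · simp
      · rw [strMap_succ]
        simp [strMap_apply]
    · obtain ⟨z, hz, rfl⟩ := (mem_stringSpan_iff r).mp hx
      choose y hy hyz using fun j => (Submodule.mem_map.mp (hz j))
      refine (mem_stringSpan_iff r).mpr ⟨Fin.cons 0 y, fun j => ?_, ?_⟩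
      · refine Fin.cases ?_ (fun i => ?_) j
        · simp
        · simpa using hy i
      · rw [strMap_succ]
        simp only [Fin.cons_zero, Fin.cons_succ, zero_add, hyz]

/-- Strings are additive in the head: `string(A + B, d) = string(A, d) + string(B, d)`. [folklore] -/
theorem stringSpan_sup (A B : Submodule ℂ V) (d : ℕ) :
    stringSpan r (A ⊔ B) d = stringSpan r A d ⊔ stringSpan r B d := by
  apply le_antisymm
  · intro x hx
    obtain ⟨y, hy, rfl⟩ := (mem_stringSpan_iff r).mp hx
    choose a ha b hb hab using fun j => Submodule.mem_sup.mp (hy j)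
    have : strMap r d y = strMap r d a + strMap r d b := by
      rw [← map_add]; congr 1; funext j; exact (hab j).symm
    rw [this]
    exact Submodule.add_mem_sup (strMap_mem_stringSpan r ha) (strMap_mem_stringSpan r hb)
  · refine sup_le (fun x hx => ?_) (fun x hx => ?_)
    · obtain ⟨y, hy, rfl⟩ := (mem_stringSpan_iff r).mp hx
      exact strMap_mem_stringSpan r fun j => Submodule.mem_sup_left (hy j)
    · obtain ⟨y, hy, rfl⟩ := (mem_stringSpan_iff r).mp hx
      exact strMap_mem_stringSpan r fun j => Submodule.mem_sup_right (hy j)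

/-- Strings are monotone in the head. [folklore] -/
theorem stringSpan_mono {A B : Submodule ℂ V} (h : A ≤ B) (d : ℕ) : stringSpan r A d ≤ stringSpan r B d := by
  intro x hx
  obtain ⟨y, hy, rfl⟩ := (mem_stringSpan_iff r).mp hx
  exact strMap_mem_stringSpan r fun j => h (hy j)

/-- The head lies in its string (`d ≥ 1`). [folklore] -/
theorem le_stringSpan_succ (H : Submodule ℂ V) (d : ℕ) : H ≤ stringSpan r H (d + 1) := by
  rw [stringSpan_succ]; exact le_sup_left

/-- A string of length `d` over a head inside an `N`-stable `U` stays inside `U`. [folklore] -/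
theorem stringSpan_le {U H : Submodule ℂ V} (hU : U ≤ U.comap r.N) (hH : H ≤ U) (d : ℕ) :
    stringSpan r H d ≤ U := by
  intro x hx
  obtain ⟨y, hy, rfl⟩ := (mem_stringSpan_iff r).mp hx
  rw [strMap_apply]
  refine Submodule.sum_mem _ fun j _ => ?_
  have : ∀ (k : ℕ) (v : V), v ∈ U → (r.N ^ k) v ∈ U := by
    intro k
    induction k with
    | zero => intro v hv; simpa using hv
    | succ k ih => intro v hv; rw [pow_succ', Module.End.mul_apply]; exact hU (ih v hv)
  exact this _ _ (hH (hy j))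

end StrMap

/-! ## Sub-Weil–Deligne representations: `ker N^j`, infima, suprema -/

/-- `ker N^j` is a sub-Weil–Deligne representation. [cite: TateCorvallis1979, (4.1.5)] -/
theorem isSubrep_ker_pow_N (r : WeilDeligneRep F ℂ V) (j : ℕ) : r.IsSubrep (LinearMap.ker (r.N ^ j)) := by
  refine ⟨IsWStable.ker_pow_N r j, fun v hv => ?_⟩
  rw [LinearMap.mem_ker] at hv
  rw [Submodule.mem_comap, LinearMap.mem_ker, ← Module.End.mul_apply, ← pow_succ, pow_succ',
    Module.End.mul_apply, hv, map_zero]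

/-- Intersections of sub-Weil–Deligne representations. [folklore] -/
theorem isSubrep_inf {r : WeilDeligneRep F ℂ V} {p q : Submodule ℂ V} (hp : r.IsSubrep p)
    (hq : r.IsSubrep q) : r.IsSubrep (p ⊓ q) :=
  ⟨IsWStable.inf hp.1 hq.1, fun _ hv => ⟨hp.2 hv.1, hq.2 hv.2⟩⟩

/-- Sums of sub-Weil–Deligne representations. [folklore] -/
theorem isSubrep_sup {r : WeilDeligneRep F ℂ V} {p q : Submodule ℂ V} (hp : r.IsSubrep p)
    (hq : r.IsSubrep q) : r.IsSubrep (p ⊔ q) := by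
  refine ⟨IsWStable.sup hp.1 hq.1, fun v hv => ?_⟩
  obtain ⟨x, hx, y, hy, rfl⟩ := Submodule.mem_sup.mp hv
  rw [Submodule.mem_comap, map_add]
  exact Submodule.add_mem _ (Submodule.mem_sup_left (hp.2 hx)) (Submodule.mem_sup_right (hq.2 hy))

/-- `⊥` is a sub-Weil–Deligne representation. [folklore] -/
theorem isSubrep_bot (r : WeilDeligneRep F ℂ V) : r.IsSubrep ⊥ :=
  ⟨IsWStable.bot, fun v hv => by rw [Submodule.mem_bot] at hv; simp [hv]⟩

/-- `ker N^j ≤ ker N^k` for `j ≤ k`. [folklore] -/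
theorem ker_pow_N_mono (r : WeilDeligneRep F ℂ V) {j k : ℕ} (h : j ≤ k) :
    LinearMap.ker (r.N ^ j) ≤ LinearMap.ker (r.N ^ k) :=
  r.N.iterateKer.monotone h

/-! ## `W_F`-stable complements (Frobenius-semisimplicity) -/

/-- **`W_F`-stable complements inside a `W_F`-stable subspace.**  For a Frobenius-semisimple `r` on a
finite-dimensional space, `ρ` is a semisimple representation of `W_F`
(`IsFrobSemisimple.isSemisimpleRepresentation`), so every `W_F`-stable `A ≤ B` has a `W_F`-stable
complement in `B` (complement in `V`, cut down to `B` by the modular law).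
[cite: Deligne1973Constantes, 8.5–8.6] -/
theorem exists_isWStable_compl [FiniteDimensional ℂ V] {r : WeilDeligneRep F ℂ V}
    (hr : r.IsFrobSemisimple) {A B : Submodule ℂ V} (hA : IsWStable r A) (hB : IsWStable r B)
    (hAB : A ≤ B) : ∃ Q : Submodule ℂ V, IsWStable r Q ∧ A ⊔ Q = B ∧ Disjoint A Q := by
  haveI := hr.isSemisimpleRepresentation
  let A' : Subrepresentation r.ρ := ⟨A, fun w _ hv => hA w hv⟩
  obtain ⟨C, hC⟩ := exists_isCompl A'
  have hinf : A ⊓ C.toSubmodule = ⊥ := by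
    have := congrArg Subrepresentation.toSubmodule hC.inf_eq_bot
    rwa [Subrepresentation.toSubmodule_inf] at this
  have hsup : A ⊔ C.toSubmodule = ⊤ := by
    have := congrArg Subrepresentation.toSubmodule hC.sup_eq_top
    rwa [Subrepresentation.toSubmodule_sup] at this
  refine ⟨C.toSubmodule ⊓ B, (IsWStable.inf (fun w _ hv => C.apply_mem_toSubmodule w hv) hB), ?_, ?_⟩
  · rw [← sup_inf_assoc_of_le _ hAB, hsup, top_inf_eq]
  · exact disjoint_iff.mpr (by rw [← inf_assoc, hinf, bot_inf_eq])

/-- **Every non-zero `W_F`-stable subspace contains a `W_F`-irreducible one** (finite dimension: a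
minimal non-zero `W_F`-stable subspace). [folklore] -/
theorem exists_isWIrreducible_le [FiniteDimensional ℂ V] (r : WeilDeligneRep F ℂ V)
    {P : Submodule ℂ V} (hP : IsWStable r P) (hP0 : P ≠ ⊥) :
    ∃ H : Submodule ℂ V, H ≤ P ∧ IsWIrreducible r H := by
  set S : Set (Submodule ℂ V) := {p | p ≠ ⊥ ∧ IsWStable r p ∧ p ≤ P}
  obtain ⟨H, ⟨hH0, hHst, hHP⟩, hmin⟩ := WellFounded.has_min wellFounded_lt S ⟨P, hP0, hP, le_rfl⟩
  refine ⟨H, hHP, hH0, hHst, fun q hq hqst => ?_⟩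
  by_cases hq0 : q = ⊥
  · exact Or.inl hq0
  · exact Or.inr (eq_of_le_of_not_lt hq (hmin q ⟨hq0, hqst, hq.trans hHP⟩))

/-! ## Independence of the pieces of a string -/

section Independence

variable (r : WeilDeligneRep F ℂ V)

/-- Powers of `N` pass through the string map: `N^k Σ N^j z_j = Σ N^j (N^k z_j)`. [folklore] -/
theorem pow_N_strMap (k d : ℕ) (z : Fin d → V) :
    (r.N ^ k) (strMap r d z) = strMap r d (fun j => (r.N ^ k) (z j)) := by
  simp only [strMap_apply, map_sum]
  refine Finset.sum_congr rfl fun j _ => ?_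
  rw [← Module.End.mul_apply, ← pow_add, add_comm, pow_add, Module.End.mul_apply]

/-- `ker N^0 = 0`. [folklore] -/
theorem ker_pow_N_zero : LinearMap.ker (r.N ^ 0) = ⊥ := by
  rw [pow_zero, Module.End.one_eq_id, LinearMap.ker_id]

variable {r}

/-- `N P` is `W_F`-stable for `W_F`-stable `P`. [cite: TateCorvallis1979, (4.1.5)] -/
theorem IsWStable.map_N {P : Submodule ℂ V} (hP : IsWStable r P) : IsWStable r (P.map r.N) := by
  simpa using hP.map_pow_N 1

/-- If `P ≤ ker N^{d+1}` meets `ker N^d` trivially, then `N P ≤ ker N^d` meets `ker N^{d-1}` trivially.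
[folklore] -/
theorem disjoint_map_N_ker {P : Submodule ℂ V} {d : ℕ}
    (hdisj : Disjoint P (LinearMap.ker (r.N ^ d))) :
    Disjoint (P.map r.N) (LinearMap.ker (r.N ^ (d - 1))) := by
  cases d with
  | zero => rw [Nat.zero_sub, ker_pow_N_zero]; exact disjoint_bot_right
  | succ d =>
    rw [Nat.add_sub_cancel, Submodule.disjoint_def]
    rintro _ ⟨p, hp, rfl⟩ hx
    rw [LinearMap.mem_ker, ← Module.End.mul_apply, ← pow_succ] at hx
    have hp0 : p = 0 := (Submodule.disjoint_def.mp hdisj) p hp (LinearMap.mem_ker.mpr hx)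
    rw [hp0, map_zero]

/-- `N P ≤ ker N^d` when `P ≤ ker N^{d+1}`. [folklore] -/
theorem map_N_le_ker {P : Submodule ℂ V} {d : ℕ} (hP : P ≤ LinearMap.ker (r.N ^ (d + 1))) :
    P.map r.N ≤ LinearMap.ker (r.N ^ d) := by
  rintro _ ⟨p, hp, rfl⟩
  have := hP hp
  rw [LinearMap.mem_ker] at this ⊢
  rwa [← Module.End.mul_apply, ← pow_succ]

variable (r) in
/-- **Independence of the pieces of a string.**  If `P ≤ ker N^d` and `N^{d-1}` is injective on `P`,
then `Σ_{j<d} N^j y_j = 0` with all `y_j ∈ P` forces `y = 0` (apply `N^{d-1}` to isolate `y_0`, then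
induct). [cite: TateCorvallis1979, (4.1.5)] -/
theorem strMap_eq_zero_imp : ∀ (d : ℕ) (P : Submodule ℂ V), P ≤ LinearMap.ker (r.N ^ d) →
    Disjoint P (LinearMap.ker (r.N ^ (d - 1))) →
    ∀ y : Fin d → V, (∀ j, y j ∈ P) → strMap r d y = 0 → y = 0 := by
  intro d
  induction d with
  | zero => intro P _ _ y _ _; funext j; exact Fin.elim0 j
  | succ d ih =>
    intro P hP hdisj y hy hsum
    rw [Nat.add_sub_cancel] at hdisj
    set z : Fin d → V := fun j => r.N (y j.succ) with hz
    have hzP : ∀ j, z j ∈ P.map r.N := fun j => Submodule.mem_map_of_mem (hy j.succ)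
    -- isolate `y 0` by applying `N^d`
    have h0 : y 0 = 0 := by
      have h1 : (r.N ^ d) (strMap r (d + 1) y) = (r.N ^ d) (y 0) := by
        rw [strMap_succ, map_add, pow_N_strMap]
        have h2 : (fun j : Fin d => (r.N ^ d) (r.N (y j.succ))) = 0 := by
          funext j
          have := hP (hy j.succ)
          rw [LinearMap.mem_ker, pow_succ, Module.End.mul_apply] at this
          simpa using this
        rw [h2, map_zero, add_zero]
      rw [hsum, map_zero] at h1
      exact (Submodule.disjoint_def.mp hdisj) _ (hy 0) (LinearMap.mem_ker.mpr h1.symm)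
    -- the tail by induction, for the head `N P`
    have hz0 : z = 0 := by
      refine ih (P.map r.N) (map_N_le_ker hP) (disjoint_map_N_ker hdisj) z hzP ?_
      have h1 : strMap r (d + 1) y = y 0 + strMap r d z := strMap_succ r d y
      rw [hsum, h0, zero_add] at h1
      exact h1.symm
    funext j
    refine Fin.cases h0 (fun i => ?_) j
    have hNy : r.N (y i.succ) = 0 := congr_fun hz0 i
    have hker : y i.succ ∈ LinearMap.ker (r.N ^ d) := by
      cases d with
      | zero => exact Fin.elim0 i
      | succ d =>
        refine ker_pow_N_mono r (Nat.succ_le_succ (Nat.zero_le d)) ?_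
        rw [LinearMap.mem_ker, pow_one]
        exact hNy
    exact (Submodule.disjoint_def.mp hdisj) _ (hy i.succ) hker

/-- Consequence: two strings over heads `A, B ≤ P` with `A ⊓ B = 0` meet trivially (under the
independence hypotheses on `P`). [folklore] -/
theorem disjoint_stringSpan_of_disjoint {d : ℕ} {P A B : Submodule ℂ V}
    (hP : P ≤ LinearMap.ker (r.N ^ d)) (hdisj : Disjoint P (LinearMap.ker (r.N ^ (d - 1))))
    (hA : A ≤ P) (hB : B ≤ P) (hAB : Disjoint A B) :
    Disjoint (stringSpan r A d) (stringSpan r B d) := by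
  rw [Submodule.disjoint_def]
  intro x hxA hxB
  obtain ⟨y, hy, rfl⟩ := (mem_stringSpan_iff r).mp hxA
  obtain ⟨y', hy', hyy'⟩ := (mem_stringSpan_iff r).mp hxB
  have h0 : y - y' = 0 := by
    refine strMap_eq_zero_imp r d P hP hdisj (y - y') (fun j => ?_) ?_
    · exact Submodule.sub_mem _ (hA (hy j)) (hB (hy' j))
    · rw [map_sub, hyy', sub_self]
  have hyy : y = y' := sub_eq_zero.mp h0
  have hy0 : y = 0 := by
    funext j
    exact (Submodule.disjoint_def.mp hAB) _ (hy j) (hyy ▸ hy' j)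
  rw [hy0, map_zero]

end Independence

/-- **Registered sub-goal `stub_strMap_eq_zero_imp` (independence of the pieces of a string)**: if
`P ≤ ker N^d` and `N^{d-1}` is injective on `P`, then `Σ_{j<d} N^j y_j = 0` with all `y_j ∈ P` forces
`y = 0`. [cite: TateCorvallis1979, (4.1.5)] -/
theorem stub_strMap_eq_zero_imp : ∀ (F : Type) [Field F] [ValuativeRel F] [TopologicalSpace F] [IsNonarchimedeanLocalField F] (V : Type) [AddCommGroup V] [Module ℂ V] (r : WeilDeligneRep F ℂ V) (d : ℕ) (P : Submodule ℂ V), P ≤ LinearMap.ker (r.N ^ d) → Disjoint P (LinearMap.ker (r.N ^ (d - 1))) → ∀ y : Fin d → V, (∀ j, y j ∈ P) → strMap r d y = 0 → y = 0 :=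
  fun _ _ _ _ _ _ _ _ r d P hP hdisj y hy h0 => strMap_eq_zero_imp r d P hP hdisj y hy h0

end Summit.Langlands.Langlands.Theorems.ReciprocityUpToIrreducibilityR

end
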